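import Mathlib
import HarnessLib

/-!
# Route `DiophantineDichotomy`, crux `KhovanskiiApproxTypeEv` (stmt-Schanuel-14972), line `lambert-liouville-kill`:
# stub `stub_expRationalLipschitz` — local Lipschitz bound of the exp-rational slot function `B/A`

Crux `Summit.Schanuel.Schanuel.Theses.DiophantineDichotomy.KhovanskiiApproxTypeEv` (item stmt-Schanuel-14972),
certificate line `lambert-liouville-kill` (skeleton `Cruxes/KhovanskiiApproxTypeEv/Lines/lambert_liouville_kill.lean`,
lead `prover-line-stmt-Schanuel-14972-a1-0`), registered stub `stub_expRationalLipschitz` (landed `--supports stmt-Schanuel-14972`).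

STUB F4 of the exp-rational extension `notLiouville_expRational_of_ev` of the certificate: for integer
polynomials `A, B` and a real point `x` with `A(x) ≠ 0`, the slot function `f(t) = B(t)/A(t)` (evaluation
via `Polynomial.aeval : ℤ[X] → ℝ`) is `C¹` at `x`, hence there are `K ≥ 1` and `δ > 0` such that for
`|t − x| < δ` one has `A(t) ≠ 0` and `|f(t) − f(x)| ≤ K |t − x|`.  In the certificate this is applied at
`t = p/q`, a Liouville convergent of `x` inside the radius `δ`, to place the rational slot `B(p/q)/A(p/q)`
within `K |x − p/q|` of `eˣ = B(x)/A(x)`.  Proof (pure Mathlib): `Polynomial.contDiff_aeval` and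
`ContDiffAt.div` give `ContDiffAt ℝ 1 f x`; `ContDiffAt.exists_lipschitzOnWith` gives `LipschitzOnWith K₀ f s`
on some `s ∈ 𝓝 x`; `ContinuousAt.eventually_ne` gives `A ≠ 0` near `x`; `Metric.eventually_nhds_iff`
extracts a radius `δ` inside both, and `LipschitzOnWith.dist_le_mul` with `K = max 1 K₀` finishes.
No tree inputs.
-/

noncomputable section

-- `Summit.Schanuel.Schanuel.…` is the mandated summit/sub-problem namespace (single-conjunct summit), hence:
set_option linter.dupNamespace false

namespace Summit.Schanuel.Schanuel.Cruxes.KhovanskiiApproxTypeEv.LambertLiouvilleKill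

open Polynomial Filter Topology

/-- The slot function `t ↦ B(t)/A(t)` of two integer polynomials `A, B` (evaluated at reals) is `Cⁿ` at
every real point `x` with `A(x) ≠ 0`: quotient of two smooth functions (`Polynomial.contDiff_aeval`,
`ContDiffAt.div`). [folklore] -/
theorem contDiffAt_aeval_div_aeval (A B : ℤ[X]) (x : ℝ) (hA : Polynomial.aeval x A ≠ 0)
    (n : WithTop ℕ∞) :
    ContDiffAt ℝ n (fun t : ℝ => Polynomial.aeval t B / Polynomial.aeval t A) x :=
  (Polynomial.contDiff_aeval B n).contDiffAt.div (Polynomial.contDiff_aeval A n).contDiffAt hA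

/-- An integer polynomial `A` (evaluated at reals) that does not vanish at `x` does not vanish on a
neighbourhood of `x` (continuity, `ContinuousAt.eventually_ne`). [folklore] -/
theorem eventually_aeval_ne_zero (A : ℤ[X]) (x : ℝ) (hA : Polynomial.aeval x A ≠ 0) :
    ∀ᶠ t in 𝓝 x, Polynomial.aeval t A ≠ 0 :=
  (Polynomial.contDiff_aeval A 0).continuous.continuousAt.eventually_ne hA

/-- **STUB F4 (local Lipschitz bound of the slot function `B/A` at `x`).**  If `A, B ∈ ℤ[X]` and
`A(x) ≠ 0` at the real point `x`, there are `K ≥ 1` and `δ > 0` with `A(t) ≠ 0` and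
`|B(t)/A(t) − B(x)/A(x)| ≤ K |t − x|` whenever `|t − x| < δ`.  Proof: `f = B/A` is `C¹` at `x`
(`contDiffAt_aeval_div_aeval`), hence Lipschitz with some constant `K₀` on some `s ∈ 𝓝 x`
(`ContDiffAt.exists_lipschitzOnWith`); intersect with the neighbourhood where `A ≠ 0`
(`eventually_aeval_ne_zero`), extract a radius `δ` (`Metric.eventually_nhds_iff`), and take
`K = max 1 K₀` (`LipschitzOnWith.dist_le_mul`, `Real.dist_eq`). [folklore] -/
theorem stub_expRationalLipschitz :
    ∀ (A B : ℤ[X]) (x : ℝ), Polynomial.aeval x A ≠ 0 → ∃ K δ : ℝ, 1 ≤ K ∧ 0 < δ ∧ ∀ t : ℝ,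
      |t - x| < δ → Polynomial.aeval t A ≠ 0 ∧
        |Polynomial.aeval t B / Polynomial.aeval t A - Polynomial.aeval x B / Polynomial.aeval x A| ≤
          K * |t - x| := by
  intro A B x hA
  -- `f = B/A` is `C¹` at `x`, hence Lipschitz with some constant `K₀` on some `s ∈ 𝓝 x`
  obtain ⟨K₀, s, hs, hLip⟩ := (contDiffAt_aeval_div_aeval A B x hA 1).exists_lipschitzOnWith
  -- a radius `δ` around `x` inside `s` on which `A` does not vanish
  have hev : ∀ᶠ t in 𝓝 x, t ∈ s ∧ Polynomial.aeval t A ≠ 0 :=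
    (Filter.eventually_mem_set.2 hs).and (eventually_aeval_ne_zero A x hA)
  obtain ⟨δ, hδ, hball⟩ := Metric.eventually_nhds_iff.1 hev
  refine ⟨max 1 (K₀ : ℝ), δ, le_max_left _ _, hδ, fun t ht => ?_⟩
  have htd : dist t x < δ := by rwa [Real.dist_eq]
  have hxd : dist x x < δ := by rwa [dist_self]
  obtain ⟨hts, htA⟩ := hball htd
  obtain ⟨hxs, -⟩ := hball hxd
  refine ⟨htA, ?_⟩
  -- the Lipschitz estimate between `t` and `x`, with `K₀ ≤ K = max 1 K₀`
  have h1 := hLip.dist_le_mul t hts x hxs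
  rw [Real.dist_eq, Real.dist_eq] at h1
  exact h1.trans (mul_le_mul_of_nonneg_right (le_max_right _ _) (abs_nonneg _))

end Summit.Schanuel.Schanuel.Cruxes.KhovanskiiApproxTypeEv.LambertLiouvilleKill

end
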